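import Summits.MatrixMultiplication.OmegaCensus.SmallFormats.MatMul22nRankGF7Slack6FlatMain
import HarnessLib

/-!
# ω-census family (a): slack-6 certificate replay — CHECK B (table part of level 1), file 23 of 23

Cell `pub-omega` (unit `pub-omega-tensor-g18`, `pub-omega-tensor-g19`), topic `Summits/MatrixMultiplication/OmegaCensus` (sub-folder `SmallFormats`).
Framing (verbatim): lottery ticket; floor = certified bounds/negative ranges. HONEST FRAMING: machine-generated kernel replay
(`pub-omega-tensor-g19/code/py/gen6_runs19.py`, from tensor g18's `gen6_runs18.py`): `SearchT6 c` for the classes `3686 ≤ c < 3692` (13237 search nodes in the glued classes of this file; big classes in pieces `searchT6p` / `searchT6f` of ≤ 3000 nodes, glued by `searchT6_of_pf`). Soundness is in `MatMul22nRankGF7Slack6SearchSound` /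
`MatMul22nRankGF7Slack6SearchFinal`; nothing here is progress on `ω`.
-/

namespace Summit.MatrixMultiplication.OmegaCensus.SmallFormats

set_option Elab.async false

set_option maxRecDepth 100000 in
set_option maxHeartbeats 400000000 in
/-- `SearchT6 c` (flat form) for `3686 ≤ c < 3691` (2576 search nodes). -/
theorem searchT6B_3686 : (allUpTo 5 fun i => decide (SearchT6Fl (3686 + i))) = true := by decide +kernel

set_option maxRecDepth 100000 in
set_option maxHeartbeats 400000000 in
/-- Class `3691`: listed level-1 children `0 ≤ t < 85` die (2989 search nodes). -/
theorem searchT6p_3691_0 : searchT6p 3691 0 85 = true := searchT6p_of_Fl (by decide +kernel)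

set_option maxRecDepth 100000 in
set_option maxHeartbeats 400000000 in
/-- Class `3691`: listed level-1 children `85 ≤ t < 157` die (2802 search nodes). -/
theorem searchT6p_3691_1 : searchT6p 3691 85 157 = true := searchT6p_of_Fl (by decide +kernel)

set_option maxRecDepth 100000 in
set_option maxHeartbeats 400000000 in
/-- Class `3691`: listed level-1 children `157 ≤ t < 223` die (2747 search nodes). -/
theorem searchT6p_3691_2 : searchT6p 3691 157 223 = true := searchT6p_of_Fl (by decide +kernel)

set_option maxRecDepth 100000 in
set_option maxHeartbeats 400000000 in
/-- Class `3691`: listed level-1 children `t ≥ 223` die (2123 search nodes; `275` children in all). -/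
theorem searchT6f_3691 : searchT6f 3691 223 = true := searchT6f_of_Fl (by decide +kernel)

/-- **`SearchT6 3691`** from its 4 pieces (10661 search nodes). -/
theorem searchT6_c3691 : SearchT6 3691 := searchT6_of_pf (searchT6p_append (Nat.zero_le _) (searchT6p_append (Nat.zero_le _) searchT6p_3691_0 searchT6p_3691_1) searchT6p_3691_2) searchT6f_3691

/-- **CHECK B (table part) for `3686 ≤ · < 3692`** (this file). -/
theorem searchT6_runT_23 : ∀ x, 3686 ≤ x → x < 3692 → SearchT6 x := by
  intro x _h1 h2
  by_cases g3691 : x < 3691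
  · have h := searchT6_of_Fl (of_decide_eq_true (allUpTo_sound searchT6B_3686 (x - 3686) (by omega)))
    rw [show 3686 + (x - 3686) = x by omega] at h
    exact h
  have e : x = 3691 := by omega
  subst e; exact searchT6_c3691

end Summit.MatrixMultiplication.OmegaCensus.SmallFormats
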